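import Literature.Analysis.FluidPDE.WholeSpaceIBP
import HarnessLib

/-!
# The divergence theorem on the whole space for integrable fields

`∫_E div w = 0` for a `C¹` vector field `w` on a finite-dimensional real inner product space `E`
such that `w` and `div w` are (Lebesgue) integrable — the boundary-free Gauss–Green formula under
the natural `L¹` hypotheses instead of compact support (`integral_divergence_eq_zero`,
`WholeSpaceIBP.lean`) or power decay (`integral_divergence_eq_zero_of_decay`,
`NSVorticityHelicityProofs.lean`, which needs `|w|, |Dw| ≲ (1+|x|)^{-r}` with `r > dim E + 1`).

Proof (the standard truncation, e.g. Evans, *PDE*, App. C.2 with cut-offs; Leray 1934, §6,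
spheres of radius `r₀ → ∞`): with the tree's cut-offs `χ_R = Fluid.cutoff R` (`= 1` on `|x| ≤ R`,
`0` on `|x| ≥ 2R`, `|Dχ_R| ≤ C/R`), `∫ χ_R div w = −∫ ⟪w, ∇χ_R⟫`
(`integral_mul_divergence_add_eq_zero_left`); the left side tends to `∫ div w` by dominated
convergence and the right side is `≤ (C/R) ‖w‖_{L¹} → 0`.

* `integral_divergence_eq_zero_of_integrable` — the statement above;
* `integral_mul_divergence_add_eq_zero_of_integrable` — `∫ θ div u + ∫ ⟪u, ∇θ⟫ = 0` for `C¹`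
  data with `θ u`, `θ div u` and `⟪u, ∇θ⟫` integrable.

Everything proved; no definitions, no named facts.

## References

* L. C. Evans, *Partial Differential Equations*, 2nd ed., AMS 2010, App. C.2, Thm. 1–2
  (Gauss–Green, integration by parts). [Evans2010]
* J. Leray, Acta Math. 63 (1934), §6, (1.11) p. 203. [Leray1934]
-/

noncomputable section

open MeasureTheory Set Function Filter Topology InnerProductSpace
open scoped RealInnerProductSpace

namespace Literature.Analysis.FluidPDE

variable {E : Type*} [NormedAddCommGroup E] [InnerProductSpace ℝ E] [FiniteDimensional ℝ E]
  [MeasurableSpace E] [BorelSpace E]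

/-- **Divergence theorem on the whole space, `L¹` form.** For a `C¹` vector field `w : E → E`
with `w ∈ L¹` and `div w ∈ L¹`, `∫ div w = 0` (truncation by `χ_R` and `R → ∞`; Evans, *PDE*,
App. C.2; Leray 1934, §6 (1.11)). [cite: Evans2010, App. C.2, Thm. 1] -/
theorem integral_divergence_eq_zero_of_integrable {w : E → E} (hw : ContDiff ℝ 1 w)
    (hint : Integrable w) (hdiv : Integrable fun x ↦ VectorCalculus.divergence w x) :
    ∫ x, VectorCalculus.divergence w x = 0 := by
  obtain ⟨C, hC0, hC⟩ := exists_norm_fderiv_cutoff_le (E := E)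
  -- `∫ χ_R div w = -∫ ⟪w, ∇χ_R⟫` for `R = n + 1`
  have hn : ∀ n : ℕ, ∫ x, cutoff ((n : ℝ) + 1) x * VectorCalculus.divergence w x =
      -∫ x, ⟪w x, gradient (cutoff ((n : ℝ) + 1)) x⟫ := by
    intro n
    have h := integral_mul_divergence_add_eq_zero_left (contDiff_cutoff _) hw
      (hasCompactSupport_cutoff (E := E) (R := (n : ℝ) + 1) (by positivity))
    linarith
  -- the left side tends to `∫ div w`
  have hL : Tendsto (fun n : ℕ ↦ ∫ x, cutoff ((n : ℝ) + 1) x * VectorCalculus.divergence w x)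
      atTop (𝓝 (∫ x, VectorCalculus.divergence w x)) := by
    refine tendsto_integral_of_dominated_convergence (fun x ↦ ‖VectorCalculus.divergence w x‖)
      (fun n ↦ ((contDiff_cutoff (n := 0) _).continuous.aestronglyMeasurable.mul
        hdiv.aestronglyMeasurable))
      hdiv.norm ?_ ?_
    · intro n
      filter_upwards with x
      rw [norm_mul]
      exact mul_le_of_le_one_left (norm_nonneg _)
        (by rw [Real.norm_eq_abs]; exact abs_cutoff_le_one _ _)
    · filter_upwards with x
      simpa using (tendsto_cutoff_natCast_add_one x).mul_const (VectorCalculus.divergence w x)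
  -- the right side tends to `0`
  have hR : Tendsto (fun n : ℕ ↦ ∫ x, ⟪w x, gradient (cutoff ((n : ℝ) + 1)) x⟫) atTop (𝓝 0) := by
    have hbound : ∀ n : ℕ, ‖∫ x, ⟪w x, gradient (cutoff ((n : ℝ) + 1)) x⟫‖ ≤
        C / ((n : ℝ) + 1) * ∫ x, ‖w x‖ := by
      intro n
      rw [← integral_const_mul]
      refine norm_integral_le_of_norm_le (hint.norm.const_mul _) ?_
      filter_upwards with x
      calc ‖⟪w x, gradient (cutoff ((n : ℝ) + 1)) x⟫‖
          ≤ ‖w x‖ * ‖gradient (cutoff ((n : ℝ) + 1)) x‖ := norm_inner_le_norm _ _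
        _ ≤ ‖w x‖ * (C / ((n : ℝ) + 1)) := by
          gcongr
          rw [gradient, LinearIsometryEquiv.norm_map]
          exact hC _ (by positivity) x
        _ = C / ((n : ℝ) + 1) * ‖w x‖ := mul_comm _ _
    have hlim : Tendsto (fun n : ℕ ↦ C / ((n : ℝ) + 1) * ∫ x, ‖w x‖) atTop (𝓝 0) := by
      have h1 : Tendsto (fun n : ℕ ↦ C / ((n : ℝ) + 1)) atTop (𝓝 0) :=
        tendsto_const_nhds.div_atTop (tendsto_natCast_atTop_atTop.atTop_add tendsto_const_nhds)
      simpa using h1.mul_const (∫ x, ‖w x‖)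
    exact squeeze_zero_norm hbound hlim
  -- conclusion
  have hL' : Tendsto (fun n : ℕ ↦ ∫ x, cutoff ((n : ℝ) + 1) x * VectorCalculus.divergence w x)
      atTop (𝓝 0) := by
    simp_rw [hn]
    simpa using hR.neg
  exact tendsto_nhds_unique hL hL'

/-- **Integration by parts on the whole space, `L¹` form**: for `θ ∈ C¹(E; ℝ)`, `u ∈ C¹(E; E)`
with `θ u`, `θ div u` and `⟪u, ∇θ⟫` integrable and `D(θ u)` giving an integrable divergence,
`∫ θ div u + ∫ ⟪u, ∇θ⟫ = 0` (`div (θ u) = θ div u + ⟪u, ∇θ⟫`,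
`integral_divergence_eq_zero_of_integrable`). [cite: Evans2010, App. C.2, Thm. 2] -/
theorem integral_mul_divergence_add_eq_zero_of_integrable {θ : E → ℝ} {u : E → E}
    (hθ : ContDiff ℝ 1 θ) (hu : ContDiff ℝ 1 u) (hint : Integrable fun x ↦ θ x • u x)
    (h₁ : Integrable fun x ↦ θ x * VectorCalculus.divergence u x)
    (h₂ : Integrable fun x ↦ ⟪u x, gradient θ x⟫) :
    (∫ x, θ x * VectorCalculus.divergence u x) + ∫ x, ⟪u x, gradient θ x⟫ = 0 := by
  rw [← integral_add h₁ h₂]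
  have hdiv : ∀ x, VectorCalculus.divergence (fun y ↦ θ y • u y) x =
      θ x * VectorCalculus.divergence u x + ⟪u x, gradient θ x⟫ := fun x ↦
    divergence_smul_apply (hθ.differentiable one_ne_zero x) (hu.differentiable one_ne_zero x)
  have h := integral_divergence_eq_zero_of_integrable (w := fun x ↦ θ x • u x) (hθ.smul hu) hint
    (by simp_rw [hdiv]; exact h₁.add h₂)
  simp_rw [hdiv] at h
  exact h

end Literature.Analysis.FluidPDE

end
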